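import Literature.Analysis.Complex.FordZeroDetector
import Literature.NumberTheory.LFunctions.ZetaLogNormVertical
import Literature.NumberTheory.LFunctions.ExplicitFormulaPsiProofs
import Literature.NumberTheory.LFunctions.ZetaLogDerivRealBound
import Literature.NumberTheory.LFunctions.ZetaZerosProofs
import HarnessLib

/-!
# Ford's zero detector for `ζ` on whole vertical lines (Ford 2002, Lemma 2.2 for `f = ζ`)

Topic `Literature/NumberTheory/LFunctions`, family RH (explicit Vinogradov–Korobov zero-free
regions: Ford 2002; Mossinghoff–Trudgian–Yang 2024). Everything in this file is PROVED; no named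
fact is introduced.

Ford's Lemma 2.2 (the "zero detector") for `f = ζ` reads, for `s = σ + it` off the zeros and
almost every `η > 0`,

  `−Re ζ'(s)/ζ(s) = (π/2η) Σ_{|Re(s−ρ)| ≤ η} m_ρ Re cot(π(ρ − s)/2η)`
  `    + (1/4η) ∫_{−∞}^{∞} [log|ζ(s − η + 2ηiu/π)| − log|ζ(s + η + 2ηiu/π)|] sech²u du`,

the sum over the zeros **and the pole** (`m = −1`) of `ζ` in the strip. The tree has the identity
on finite rectangles for any analytic `f` (`Literature.Analysis.Complex.FordDetector.ford_zero_detector_rect`,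
with explicit horizontal-edge terms). This file lets the horizontal edges recede for `f = ζ₁`,
`ζ₁(s) = (s − 1)ζ(s)` (entire; `ζ₁'/ζ₁ = ζ'/ζ + 1/(s − 1)`), and packages the result in the form in
which Ford's Lemma 4.1 and MTY's Lemmas 4.2, 4.7, 6.1 use it: an **upper bound** for
`−Re ζ'/ζ(s)` in which any zeros may be omitted (for `Re s ≥ 1` every zero enters with
`Re h_η(ρ − s) ≤ 0`):

* `FordZetaDetector.neg_re_deriv_riemannZeta₁_div_le` — for `t ≠ 0`, `σ ≥ 1`, `η > 0`,
  `1/2 ≤ σ − η`, `σ + η ≤ 3`, no zero of `ζ` on `Re z = σ − η`, and `S` any finite set of zeros with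
  `Re ρ > σ − η`:
  `−Re (ζ₁'/ζ₁)(s) ≤ Σ_{ρ∈S} m(ρ) Re h_η(ρ − s) + (π/8η²)[∫ log|ζ₁(σ−η+iy)| k − ∫ log|ζ₁(σ+η+iy)| k]`,
  `k(y) = sech²(π(y − t)/2η)`, `h_η(z) = (π/2η)cot(πz/2η)`, `m = riemannZetaZeroOrder`;
* `FordZetaDetector.neg_re_deriv_riemannZeta_div_le` — the same for `ζ`:
  `−Re (ζ'/ζ)(s) ≤ (σ−1)/|s−1|² + Σ_{ρ∈S} m(ρ) Re h_η(ρ − s) + (π/8η²)[∫ log|ζ(σ−η+iy)| k − ∫ log|ζ(σ+η+iy)| k]`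
  (the pole: `Re 1/(s−1) = (σ−1)/|s−1|²`, and `∫ [log|σ−η−1+iy| − log|σ+η−1+iy|] k ≤ 0`);
* `FordZetaDetector.ford_zero_detector_zeta` — Ford's parametrisation `y = t + 2ηu/π`:
  `… + (1/4η)[∫ log|ζ(σ−η+i(t+2ηu/π))|/cosh²u du − ∫ log|ζ(σ+η+i(t+2ηu/π))|/cosh²u du]`, whose
  integrals are literally `fordLogZetaIntegral (σ ∓ η) t (2η/π)` of
  `VinogradovKorobovZeroDetector.lean` (not imported here).

On the pole term. Ford's Lemma 4.1 (`1 ≤ σ ≤ 1 + η`) drops the pole of `ζ` silently; its exact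
contribution to the right-hand side is `Re h_η(s − 1) = (π/2η) sin 2x/(cosh 2y − cos 2x) ≥ 0`,
`x = π(σ−1)/2η`, `y = πt/2η` — about `e^{−πt/η}`, and **exactly `0` for `σ = 1`**, the only case used
by Ford's Lemma 4.6 and by MTY. Here it appears as `(σ − 1)/|s − 1|² ≥ 0` plus a non-positive
integral that we discard, so the statements are honest upper bounds for every `σ ≥ 1` and lose
nothing at `σ = 1`.

## Proof

Good heights `T_n ∈ [n, n+1]` at distance `δ_n ≫ 1/log n` from all ordinates
(`ExplicitPsi.exists_goodHeight_all`); on `[1/2, 3] × {±T_n}`: `|ζ₁'/ζ₁| ≤ C log(T_n+4)/δ_n + 3`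
(`PsiOneExplicit.exists_norm_logDeriv_riemannZeta_horizontal_le` on `[−1/2, 3/2]`,
`|ζ'/ζ| < 1/(σ − 1)` beyond, `norm_deriv_riemannZeta_div_lt`). Apply `ford_zero_detector_rect` to
`ζ₁` on `[σ−η, σ+η] × [−T_n, T_n]`; the zeros outside `S` have `σ − η < Re ρ < 1 ≤ σ` and enter with
`Re h_η ≤ 0` (`FordDetector.re_fordCot_nonpos`); the horizontal terms are
`≤ (2η)²(C log/δ + 3)(π/2η)² · 16e^{−π(T_n − |t|)/η} → 0`; and
`∫_{−T_n}^{T_n} → ∫_ℝ` because `log|ζ₁(x + iy)| sech²` is integrable on every line `x ∈ [1/2, 3]`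
(`ZetaLogNormVertical.integrable_log_norm_riemannZeta₁_div_cosh_sq`, Titchmarsh 9.6 (B)).

What is NOT here: the removal of the hypothesis "no zero on `Re z = σ − η`" (by `η' ↓ η`, all
terms of Lemma 4.1's final bound being continuous in `η`), and the bound of the left integral by
`(3.1)` (Ford's Lemma 3.4, `FordLogZetaIntegralBound.lean`): that is Lemma 4.1 proper.

## References

* K. Ford, *Zero-free regions for the Riemann zeta function*, Number Theory for the Millennium II
  (Urbana 2000), A K Peters 2002, 25–56 (arXiv:1910.08205): Lemma 2.2, Lemma 4.1 and its proof.
  [Ford2002Millennium]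
* M. J. Mossinghoff, T. S. Trudgian, A. Yang, *Explicit zero-free regions for the Riemann
  zeta-function*, Res. Number Theory 10 (2024): Lemma 4.1. [MossinghoffTrudgianYangRNT2024]
* H. L. Montgomery, R. C. Vaughan, *Multiplicative Number Theory I*, CUP 2007, Lemma 12.2 (good
  heights, `ζ'/ζ` on horizontal segments). [MontgomeryVaughan2007]
-/

noncomputable section

open Complex Set Metric Filter Topology MeasureTheory Real intervalIntegral
open Literature.Analysis.Complex Literature.Analysis.Complex.FordDetector

namespace Literature.NumberTheory.LFunctions

namespace FordZetaDetector

/-! ### Non-vanishing of `ζ₁` on the contour -/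

/-- `ζ₁(z) ≠ 0` for `Re z ≥ 1` (`ζ ≠ 0` there, and `ζ₁(1) = 1`). [folklore] -/
theorem riemannZeta₁_ne_zero_of_one_le_re {z : ℂ} (hz : 1 ≤ z.re) : riemannZeta₁ z ≠ 0 := by
  intro h
  have hz1 := ne_one_of_riemannZeta₁_eq_zero h
  exact riemannZeta_ne_zero_of_one_le_re hz ((riemannZeta₁_eq_zero_iff hz1).1 h)

/-- A zero of `ζ₁` with `Re z > 0` is a non-trivial zero of `ζ`. [folklore] -/
theorem mem_nontrivialZeros_of_riemannZeta₁_eq_zero {z : ℂ} (hz : 0 < z.re) (h : riemannZeta₁ z = 0) :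
    z ∈ RHWave0.riemannZetaNontrivialZeros := by
  have hz1 := ne_one_of_riemannZeta₁_eq_zero h
  have hζ := (riemannZeta₁_eq_zero_iff hz1).1 h
  have hlt : z.re < 1 := by
    by_contra hge
    exact riemannZeta_ne_zero_of_one_le_re (not_lt.1 hge) hζ
  exact (mem_riemannZetaNontrivialZeros_iff_holds).2 ⟨hζ, hz, hlt⟩

/-- At a height `d` avoided by the ordinates of the non-trivial zeros, `ζ₁ ≠ 0` on `Re z > 0`.
[folklore] -/
theorem riemannZeta₁_ne_zero_of_goodHeight {d δ : ℝ} (hδ : 0 < δ)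
    (hsep : ∀ ρ ∈ RHWave0.riemannZetaNontrivialZeros, δ ≤ |ρ.im - d|) {x : ℝ} (hx : 0 < x) :
    riemannZeta₁ (x + d * I) ≠ 0 := by
  intro h
  have hmem := mem_nontrivialZeros_of_riemannZeta₁_eq_zero (by simpa using hx) h
  have := hsep _ hmem
  simp at this
  linarith

/-! ### `ζ₁'/ζ₁` on the horizontal edges at good heights -/

/-- `ζ₁'/ζ₁ = ζ'/ζ + 1/(z − 1)` (as `deriv f / f`) where `z ≠ 1`, `ζ(z) ≠ 0`. [folklore] -/
theorem deriv_riemannZeta₁_div_eq {z : ℂ} (hz : z ≠ 1) (hζ : riemannZeta z ≠ 0) :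
    deriv riemannZeta₁ z / riemannZeta₁ z = deriv riemannZeta z / riemannZeta z + (z - 1)⁻¹ := by
  have h := logDeriv_riemannZeta_eq hz hζ
  rw [logDeriv_apply, logDeriv_apply] at h
  rw [h]; ring

/-- **`ζ₁'/ζ₁` on a horizontal segment at a good height.** There is an absolute `C` such that for
`|T| ≥ 2`, `0 < δ ≤ 1`, all non-trivial zeros `δ`-away from the ordinate `T`, and `1/2 ≤ x ≤ 3`:
`‖ζ₁'/ζ₁(x + iT)‖ ≤ C log(|T| + 4)/δ + 3` (the tree's bound `C log(|T|+4)/δ` for `ζ'/ζ` on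
`[−1/2, 3/2]`, `|ζ'/ζ| < 1/(x − 1) < 2` beyond, and `|1/(z − 1)| ≤ 1`).
[cite: MontgomeryVaughan2007, Lemma 12.2] -/
theorem exists_norm_deriv_riemannZeta₁_div_le :
    ∃ C : ℝ, 0 < C ∧ ∀ (T δ : ℝ), 2 ≤ |T| → 0 < δ → δ ≤ 1 →
      (∀ ρ ∈ RHWave0.riemannZetaNontrivialZeros, δ ≤ |ρ.im - T|) →
      ∀ x : ℝ, x ∈ Icc (1 / 2 : ℝ) 3 →
        ‖deriv riemannZeta₁ (x + T * I) / riemannZeta₁ (x + T * I)‖ ≤ C * Real.log (|T| + 4) / δ + 3 := by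
  obtain ⟨C, hC0, hC⟩ := PsiOneExplicit.exists_norm_logDeriv_riemannZeta_horizontal_le
  refine ⟨C, hC0, fun T δ hT hδ hδ1 hsep x hx ↦ ?_⟩
  set z : ℂ := (x : ℂ) + T * I with hz
  have hzre : z.re = x := by simp [hz]
  have hzim : z.im = T := by simp [hz]
  have hT0 : T ≠ 0 := by intro h; rw [h, abs_zero] at hT; linarith
  have hz1 : z ≠ 1 := by
    intro h; have := congrArg Complex.im h; rw [hzim] at this; simp at this; exact hT0 this
  have hζ₁ : riemannZeta₁ z ≠ 0 := riemannZeta₁_ne_zero_of_goodHeight hδ hsep (by linarith [hx.1])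
  have hζ : riemannZeta z ≠ 0 := fun h ↦ hζ₁ (by rw [riemannZeta₁_eq_mul hz1, h, mul_zero])
  rw [deriv_riemannZeta₁_div_eq hz1 hζ]
  have hinv : ‖(z - 1)⁻¹‖ ≤ 1 := by
    rw [norm_inv]
    have h2 : 2 ≤ ‖z - 1‖ := by
      have := abs_im_le_norm (z - 1)
      rw [sub_im, one_im, sub_zero, hzim] at this
      linarith
    exact inv_le_one_of_one_le₀ (by linarith)
  have hlog : 0 ≤ C * Real.log (|T| + 4) / δ := by
    have : 0 ≤ Real.log (|T| + 4) := Real.log_nonneg (by linarith [abs_nonneg T])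
    positivity
  refine (norm_add_le _ _).trans ?_
  rcases le_or_gt x (3 / 2) with hx32 | hx32
  · have := hC T δ hT hδ hδ1 hsep x ⟨by linarith [hx.1], hx32⟩
    linarith
  · have h1 : ‖deriv riemannZeta z / riemannZeta z‖ < 1 / (z.re - 1) :=
      norm_deriv_riemannZeta_div_lt (by rw [hzre]; linarith)
    rw [hzre] at h1
    have h2 : 1 / (x - 1) < 2 := by
      rw [div_lt_iff₀ (by linarith)]; linarith
    linarith

/-! ### The decay of the horizontal-edge terms -/

/-- `1/sinh²x ≤ 16 e^{−2x}` for `x ≥ 1`. [folklore] -/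
theorem one_div_sinh_sq_le {x : ℝ} (hx : 1 ≤ x) : 1 / Real.sinh x ^ 2 ≤ 16 * Real.exp (-(2 * x)) := by
  have hex : Real.exp 1 ≤ Real.exp x := Real.exp_le_exp.2 hx
  have he1 : 2 < Real.exp 1 := by have := Real.exp_one_gt_d9; linarith
  have hpos : 0 < Real.exp x := Real.exp_pos x
  have hinv : Real.exp (-x) * Real.exp x = 1 := by rw [← Real.exp_add]; simp
  have hsinh : Real.exp x / 4 ≤ Real.sinh x := by
    rw [Real.sinh_eq]
    -- e^{-x} ≤ e^{x}/2 since e^{2x} ≥ 2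
    have : Real.exp (-x) ≤ Real.exp x / 2 := by
      rw [Real.exp_neg, inv_le_iff_one_le_mul₀ hpos]
      nlinarith
    linarith
  have hs0 : 0 < Real.sinh x := lt_of_lt_of_le (by positivity) hsinh
  rw [div_le_iff₀ (pow_pos hs0 2), show -(2 * x) = -x + -x by ring, Real.exp_add]
  have h16 : 1 ≤ 16 * (Real.exp (-x) * Real.exp (-x)) * (Real.exp x / 4) ^ 2 := by
    have : 16 * (Real.exp (-x) * Real.exp (-x)) * (Real.exp x / 4) ^ 2 =
        (Real.exp (-x) * Real.exp x) ^ 2 := by ring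
    rw [this, hinv]; norm_num
  calc (1 : ℝ) ≤ 16 * (Real.exp (-x) * Real.exp (-x)) * (Real.exp x / 4) ^ 2 := h16
    _ ≤ 16 * (Real.exp (-x) * Real.exp (-x)) * Real.sinh x ^ 2 := by
        gcongr

/-- `(x + a)² e^{−bx} → 0` as `x → ∞` (`b > 0`). [folklore] -/
theorem tendsto_sq_mul_exp_neg (a : ℝ) {b : ℝ} (hb : 0 < b) :
    Tendsto (fun x : ℝ ↦ (x + a) ^ 2 * Real.exp (-(b * x))) atTop (𝓝 0) := by
  -- ((x + a) e^{-bx/2})² with (x + a) e^{-bx/2} → 0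
  have h1 : Tendsto (fun x : ℝ ↦ x * Real.exp (-(b / 2 * x))) atTop (𝓝 0) := by
    have h := (Real.tendsto_pow_mul_exp_neg_atTop_nhds_zero 1).comp
      (tendsto_id.const_mul_atTop (by positivity : 0 < b / 2))
    have h' : Tendsto (fun x : ℝ ↦ 2 / b * ((b / 2 * x) ^ 1 * Real.exp (-(b / 2 * x)))) atTop (𝓝 (2 / b * 0)) :=
      h.const_mul (2 / b)
    rw [mul_zero] at h'
    refine h'.congr fun x ↦ ?_
    field_simp
  have h2 : Tendsto (fun x : ℝ ↦ a * Real.exp (-(b / 2 * x))) atTop (𝓝 0) := by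
    have h := (Real.tendsto_exp_neg_atTop_nhds_zero).comp
      (tendsto_id.const_mul_atTop (by positivity : 0 < b / 2))
    have h' := h.const_mul a
    rw [mul_zero] at h'
    exact h'.congr fun x ↦ by simp [Function.comp]
  have h3 := (h1.add h2).pow 2
  rw [zero_add, zero_pow two_ne_zero] at h3
  refine h3.congr fun x ↦ ?_
  rw [show -(b * x) = -(b / 2 * x) + -(b / 2 * x) by ring, Real.exp_add]
  ring

/-! ### The horizontal-edge term of the detector for `ζ₁` at a good height -/

/-- The polylogarithmic growth of the edge bound: `C log(d + 4)/δ + 3 ≤ (C(1 + 1/c₀) + 3)(d + 4)²`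
when `1/δ ≤ 2 + log(d + 2)/c₀`, `d ≥ 0`. [folklore] -/
theorem edge_bound_le_sq {C c₀ δ d : ℝ} (hC : 0 ≤ C) (hc₀ : 0 < c₀) (hδ : 0 < δ) (hd : 0 ≤ d)
    (hδinv : 1 / δ ≤ 2 + Real.log (d + 2) / c₀) :
    C * Real.log (d + 4) / δ + 3 ≤ (C * (1 + 1 / c₀) + 3) * (d + 4) ^ 2 := by
  have hlog1 : Real.log (d + 4) ≤ d + 4 := by
    have := Real.log_le_sub_one_of_pos (by linarith : 0 < d + 4); linarith
  have hlog2 : Real.log (d + 2) ≤ d + 2 := by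
    have := Real.log_le_sub_one_of_pos (by linarith : 0 < d + 2); linarith
  have hlog0 : 0 ≤ Real.log (d + 4) := Real.log_nonneg (by linarith)
  have h1 : C * Real.log (d + 4) / δ = C * Real.log (d + 4) * (1 / δ) := by ring
  have h2 : 1 / δ ≤ 2 + (d + 2) / c₀ := by
    have h3 : Real.log (d + 2) / c₀ ≤ (d + 2) / c₀ := div_le_div_of_nonneg_right hlog2 hc₀.le
    linarith
  have h4 : 2 + (d + 2) / c₀ ≤ (d + 4) * (1 + 1 / c₀) := by
    rw [mul_add, mul_one, mul_one_div]
    have : (d + 2) / c₀ ≤ (d + 4) / c₀ := div_le_div_of_nonneg_right (by linarith) hc₀.le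
    linarith
  have h5 : C * Real.log (d + 4) * (1 / δ) ≤ C * (d + 4) * ((d + 4) * (1 + 1 / c₀)) :=
    mul_le_mul (mul_le_mul_of_nonneg_left hlog1 hC) (h2.trans h4) (by positivity) (by positivity)
  have h6 : (3 : ℝ) ≤ 3 * (d + 4) ^ 2 := by nlinarith
  have e : (C * (1 + 1 / c₀) + 3) * (d + 4) ^ 2 =
      C * (d + 4) * ((d + 4) * (1 + 1 / c₀)) + 3 * (d + 4) ^ 2 := by ring
  rw [h1, e]
  linarith only [h5, h6]

/-- `1/sinh²(ν(y − t)) ≤ 16 e^{−2ν(D − |t|)}` when `|y − t| ≥ D − |t|` and `ν(D − |t|) ≥ 1`.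
[folklore] -/
theorem kernel_edge_decay {ν t y D : ℝ} (hν : 0 < ν) (h1 : 1 ≤ ν * (D - |t|))
    (hy : D - |t| ≤ |y - t|) :
    ν ^ 2 / Real.sinh (ν * (y - t)) ^ 2 ≤ ν ^ 2 * (16 * Real.exp (-(2 * (ν * (D - |t|))))) := by
  rw [div_eq_mul_one_div]
  refine mul_le_mul_of_nonneg_left ?_ (by positivity)
  refine le_trans ?_ (one_div_sinh_sq_le h1)
  have hD : 0 < D - |t| := by
    by_contra h
    have h' : D - |t| ≤ 0 := not_lt.1 h
    nlinarith
  have hs0 : 0 < Real.sinh (ν * (D - |t|)) := Real.sinh_pos_iff.2 (by positivity)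
  refine div_le_div_of_nonneg_left zero_le_one (pow_pos hs0 2) ?_
  have hmono : Real.sinh (ν * (D - |t|)) ≤ Real.sinh (ν * |y - t|) :=
    Real.sinh_le_sinh.2 (mul_le_mul_of_nonneg_left hy hν.le)
  have heq : Real.sinh (ν * (y - t)) ^ 2 = Real.sinh (ν * |y - t|) ^ 2 := by
    rcases le_or_gt 0 (y - t) with h | h
    · rw [abs_of_nonneg h]
    · rw [abs_of_neg h, mul_neg, Real.sinh_neg, neg_sq]
  rw [heq]
  exact pow_le_pow_left₀ hs0.le hmono 2

/-- **The horizontal-edge term for `ζ₁` at a good height.** For `s = σ + it`, `1/2 ≤ σ − η`,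
`σ + η ≤ 3`, `0 < η ≤ 2`, a height `y` with `|y| ≥ |t| + 2` whose distance from every ordinate is
`≥ δ ∈ (0, 1]`, and the constant `C` of `exists_norm_deriv_riemannZeta₁_div_le`:
`‖H(y)‖ ≤ (2η)² (C log(|y| + 4)/δ + 3) (π/2η)² · 16 e^{−π(|y| − |t|)/η}`.
[cite: Ford2002Millennium, §2, proof of Lemma 2.2] -/
theorem norm_fordHorizontalTerm_riemannZeta₁_le {σ η t y δ C : ℝ} (hη : 0 < η) (hη2 : η ≤ 2)
    (hleft : 1 / 2 ≤ σ - η) (hright : σ + η ≤ 3)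
    (hC : ∀ (T δ : ℝ), 2 ≤ |T| → 0 < δ → δ ≤ 1 →
      (∀ ρ ∈ RHWave0.riemannZetaNontrivialZeros, δ ≤ |ρ.im - T|) →
      ∀ x : ℝ, x ∈ Icc (1 / 2 : ℝ) 3 →
        ‖deriv riemannZeta₁ (x + T * I) / riemannZeta₁ (x + T * I)‖ ≤ C * Real.log (|T| + 4) / δ + 3)
    (hδ0 : 0 < δ) (hδ1 : δ ≤ 1) (hsep : ∀ ρ ∈ RHWave0.riemannZetaNontrivialZeros, δ ≤ |ρ.im - y|)
    (hy : |t| + 2 ≤ |y|) :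
    ‖fordHorizontalTerm riemannZeta₁ η ((σ : ℂ) + t * I) (σ - η) (σ + η) y‖ ≤
      (2 * η) ^ 2 * (C * Real.log (|y| + 4) / δ + 3) *
        ((π / (2 * η)) ^ 2 * (16 * Real.exp (-(2 * (π / (2 * η) * (|y| - |t|)))))) := by
  set ν : ℝ := π / (2 * η) with hν
  have hν0 : 0 < ν := by positivity
  have hy2 : 2 ≤ |y| := le_trans (by linarith [abs_nonneg t]) hy
  have hM : ∀ x ∈ Icc (σ - η) (σ + η),
      ‖deriv riemannZeta₁ (x + y * I) / riemannZeta₁ (x + y * I)‖ ≤ C * Real.log (|y| + 4) / δ + 3 :=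
    fun x hx ↦ hC y δ hy2 hδ0 hδ1 hsep x ⟨by linarith [hx.1], by linarith [hx.2]⟩
  have hF : ∀ x ∈ Icc (σ - η) (σ + η),
      ContinuousAt (fun z ↦ deriv riemannZeta₁ z / riemannZeta₁ z) (x + y * I) := fun x hx ↦
    continuousAt_logDeriv (differentiable_riemannZeta₁.analyticAt _)
      (riemannZeta₁_ne_zero_of_goodHeight hδ0 hsep (by linarith [hx.1]))
  have hab : σ - η ≤ σ + η := by linarith
  have hyt : y ≠ ((σ : ℂ) + t * I).im := by
    simp only [add_im, ofReal_im, mul_im, ofReal_re, I_im, mul_one, I_re, mul_zero, add_zero, zero_add]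
    intro h; rw [h] at hy; linarith
  have H := norm_fordHorizontalTerm_le (f := riemannZeta₁) (z₀ := (σ : ℂ) + t * I) hη hab hF hM hyt
  have him : ((σ : ℂ) + t * I).im = t := by simp
  rw [him, show σ + η - (σ - η) = 2 * η by ring] at H
  refine H.trans (mul_le_mul_of_nonneg_left ?_ ?_)
  · have hν1 : 1 / 2 ≤ ν := by
      rw [hν, le_div_iff₀ (by positivity)]
      have := Real.pi_gt_three
      nlinarith
    refine kernel_edge_decay hν0 (by nlinarith) ?_
    have := abs_sub_abs_le_abs_sub y t
    linarith
  · have h0 := (norm_nonneg _).trans (hM (σ - η) ⟨le_rfl, hab⟩)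
    exact mul_nonneg (by positivity) h0

/-! ### Change of variables to Ford's parametrisation -/

/-- `∫ g(y) sech²(ν(y − t)) dy = ν⁻¹ ∫ g(t + u/ν) sech²u du` (`ν > 0`). [folklore] -/
theorem integral_div_cosh_sq_comp (g : ℝ → ℝ) (t : ℝ) {ν : ℝ} (hν : 0 < ν) :
    ∫ y : ℝ, g y / Real.cosh (ν * (y - t)) ^ 2 =
      1 / ν * ∫ u : ℝ, g (t + u * (1 / ν)) / Real.cosh u ^ 2 := by
  set Φ : ℝ → ℝ := fun y ↦ g y / Real.cosh (ν * (y - t)) ^ 2 with hΦ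
  have h1 : (fun u : ℝ ↦ g (t + u * (1 / ν)) / Real.cosh u ^ 2) = fun u ↦ (fun x ↦ Φ (t + x)) (ν⁻¹ * u) := by
    ext u
    simp only [hΦ]
    have e1 : t + ν⁻¹ * u = t + u * (1 / ν) := by ring
    have e2 : ν * (t + ν⁻¹ * u - t) = u := by field_simp; ring
    rw [e1.symm, e2]
  rw [h1, Measure.integral_comp_inv_mul_left (fun x ↦ Φ (t + x)) ν, integral_add_left_eq_self Φ t,
    abs_of_pos hν, smul_eq_mul]
  field_simp

/-! ### The detector for `ζ₁` on whole lines -/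

set_option maxHeartbeats 800000 in
/-- **Ford's zero detector for `ζ₁ = (s−1)ζ(s)` on whole vertical lines** (Ford 2002, Lemma 2.2
with `f = ζ`, `T → ∞` carried out, inequality form). Let `s = σ + it`, `t ≠ 0`, `σ ≥ 1`, `η > 0`
with `1/2 ≤ σ − η`, `σ + η ≤ 3`, assume no zero of `ζ` lies on the line `Re z = σ − η` (Ford's
"good `η`"; the bad ones are countably many), and let `S` be any finite set of zeros of `ζ` with
`Re ρ > σ − η`. Then, with `h_η(z) = (π/2η) cot(πz/2η)` and `m(ρ)` the multiplicity,
`−Re (ζ₁'/ζ₁)(s) ≤ Σ_{ρ ∈ S} m(ρ) Re h_η(ρ − s)`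
`   + (π/8η²) [∫ log|ζ₁(σ−η+iy)| sech²(π(y−t)/2η) dy − ∫ log|ζ₁(σ+η+iy)| sech²(π(y−t)/2η) dy]`
(integrals over `ℝ`, absolutely convergent by `ZetaLogNormVertical`). Proof: the finite-rectangle
identity `FordDetector.ford_zero_detector_rect` on `[σ−η, σ+η] × [−T_n, T_n]` at the good heights
`T_n ∈ [n, n+1]` of `ExplicitPsi.exists_goodHeight_all`; the zeros outside `S` contribute `≤ 0`
(`FordDetector.re_fordCot_nonpos`, as `Re ρ < 1 ≤ σ`); the horizontal terms are
`≪ η² log²T_n · η⁻² e^{−π(T_n − |t|)/η} → 0` (`FordDetector.norm_fordHorizontalTerm_le` with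
`|ζ₁'/ζ₁| ≪ log²T_n` on the edges); the truncated line integrals converge by dominated convergence.
[cite: Ford2002Millennium, Lemma 2.2 and proof of Lemma 4.1] -/
theorem neg_re_deriv_riemannZeta₁_div_le {σ t η : ℝ} (hη : 0 < η) (hσ : 1 ≤ σ)
    (hleft : 1 / 2 ≤ σ - η) (hright : σ + η ≤ 3) (ht : t ≠ 0)
    (hgood : ∀ ρ : ℂ, riemannZeta ρ = 0 → ρ.re ≠ σ - η)
    (S : Finset ℂ) (hS : ∀ ρ ∈ S, riemannZeta ρ = 0 ∧ σ - η < ρ.re) :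
    -(deriv riemannZeta₁ (σ + t * I) / riemannZeta₁ (σ + t * I)).re ≤
      (∑ ρ ∈ S, (riemannZetaZeroOrder ρ : ℝ) * (fordCot η (ρ - (σ + t * I))).re)
      + π / (8 * η ^ 2) *
        ((∫ y : ℝ, Real.log ‖riemannZeta₁ ((σ - η : ℝ) + y * I)‖ / Real.cosh (π / (2 * η) * (y - t)) ^ 2)
          - ∫ y : ℝ, Real.log ‖riemannZeta₁ ((σ + η : ℝ) + y * I)‖ / Real.cosh (π / (2 * η) * (y - t)) ^ 2) := by
  classical
  obtain ⟨c₀, hc₀, hgh⟩ := ExplicitPsi.exists_goodHeight_all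
  obtain ⟨C, hC0, hC⟩ := exists_norm_deriv_riemannZeta₁_div_le
  have hchoice : ∀ n : ℕ, ∃ d : ℝ, (n : ℝ) ≤ d ∧ d ≤ n + 1 ∧ ∃ δ : ℝ, 0 < δ ∧ δ ≤ 1 ∧
      1 / δ ≤ 2 + Real.log (d + 2) / c₀ ∧
      ∀ ρ ∈ RHWave0.riemannZetaNontrivialZeros, δ ≤ |ρ.im - d| ∧ δ ≤ |ρ.im + d| :=
    fun n ↦ hgh n (Nat.cast_nonneg n)
  choose d hd_ge hd_le δ hδ0 hδ1 hδinv hδsep using hchoice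
  -- notation
  set s : ℂ := (σ : ℂ) + t * I with hs
  set ν : ℝ := π / (2 * η) with hν
  have hν0 : 0 < ν := by positivity
  set F : ℂ → ℂ := fun z ↦ deriv riemannZeta₁ z / riemannZeta₁ z with hF
  set G : ℝ → ℝ := fun y ↦ (Real.log ‖riemannZeta₁ ((σ - η : ℝ) + y * I)‖ -
    Real.log ‖riemannZeta₁ ((σ + η : ℝ) + y * I)‖) / Real.cosh (ν * (y - t)) ^ 2 with hG
  set ZS : ℝ := ∑ ρ ∈ S, (riemannZetaZeroOrder ρ : ℝ) * (fordCot η (ρ - s)).re with hZS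
  have hsre : s.re = σ := by simp [hs]
  have hsim : s.im = t := by simp [hs]
  have habs_t : 0 < |t| := abs_pos.2 ht
  -- integrability on the two lines
  have hIL := ZetaLogNormVertical.integrable_log_norm_riemannZeta₁_div_cosh_sq
    (σ := σ - η) ⟨hleft, by linarith⟩ hν0 t
  have hIR := ZetaLogNormVertical.integrable_log_norm_riemannZeta₁_div_cosh_sq
    (σ := σ + η) ⟨by linarith, hright⟩ hν0 t
  have hGint : Integrable G := by
    refine (hIL.sub hIR).congr (ae_of_all _ fun y ↦ ?_)
    simp only [hG, Pi.sub_apply, sub_div]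
  have hGeq : ∫ y, G y = (∫ y : ℝ, Real.log ‖riemannZeta₁ ((σ - η : ℝ) + y * I)‖ / Real.cosh (ν * (y - t)) ^ 2)
      - ∫ y : ℝ, Real.log ‖riemannZeta₁ ((σ + η : ℝ) + y * I)‖ / Real.cosh (ν * (y - t)) ^ 2 := by
    rw [← integral_sub hIL hIR]
    refine integral_congr_ae (ae_of_all _ fun y ↦ ?_)
    simp only [hG, sub_div]
  -- non-vanishing
  have h0 : riemannZeta₁ s ≠ 0 := riemannZeta₁_ne_zero_of_one_le_re (by rw [hsre]; exact hσ)
  have h_left : ∀ y : ℝ, riemannZeta₁ ((σ - η : ℝ) + y * I) ≠ 0 := by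
    intro y h0'
    have hz1 := ne_one_of_riemannZeta₁_eq_zero h0'
    exact hgood _ ((riemannZeta₁_eq_zero_iff hz1).1 h0') (by simp)
  have h_right : ∀ y : ℝ, riemannZeta₁ ((σ + η : ℝ) + y * I) ≠ 0 := fun y ↦
    riemannZeta₁_ne_zero_of_one_le_re (by simp; linarith)
  have h_hor : ∀ n : ℕ, ∀ x ∈ Icc (σ - η) (σ + η),
      riemannZeta₁ (x + d n * I) ≠ 0 ∧ riemannZeta₁ (x + (-d n : ℝ) * I) ≠ 0 := by
    intro n x hx
    have hx0 : 0 < x := by linarith [hx.1]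
    refine ⟨riemannZeta₁_ne_zero_of_goodHeight (hδ0 n) (fun ρ hρ ↦ (hδsep n ρ hρ).1) hx0,
      riemannZeta₁_ne_zero_of_goodHeight (hδ0 n) (fun ρ hρ ↦ ?_) hx0⟩
    have := (hδsep n ρ hρ).2
    rwa [sub_neg_eq_add]
  -- Step A: the finite-rectangle identity at the good heights `± d n`, `n ≥ |t| + 2`
  have hrect : ∀ n : ℕ, |t| + 2 ≤ (n : ℝ) →
      -(F s).re =
        (∑ᶠ ρ ∈ {ρ : ℂ | riemannZeta₁ ρ = 0 ∧ ρ ∈ Ioo (σ - η) (σ + η) ×ℂ Ioo (-d n) (d n)},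
            ((meromorphicOrderAt riemannZeta₁ ρ).untop₀ : ℝ) * (fordCot η (ρ - s)).re)
        + π / (8 * η ^ 2) * (∫ y : ℝ in (-d n : ℝ)..d n, G y)
        - 1 / (2 * π) * ((fordHorizontalTerm riemannZeta₁ η s (σ - η) (σ + η) (d n)).im
            - (fordHorizontalTerm riemannZeta₁ η s (σ - η) (σ + η) (-d n)).im) := by
    intro n hn
    have hdn : |t| < d n := by linarith [hd_ge n]
    have hc : -d n < t := by have := neg_abs_le t; linarith
    have hd : t < d n := lt_of_le_of_lt (le_abs_self t) hdn
    have h := ford_zero_detector_rect (f := riemannZeta₁) (x₀ := σ) (y₀ := t) (c := -d n)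
      (d := d n) hη hc hd (fun z _ ↦ differentiable_riemannZeta₁.analyticAt z)
      (fun x hx ↦ (h_hor n x hx).2) (fun x hx ↦ (h_hor n x hx).1)
      (fun y _ ↦ h_left y) (fun y _ ↦ h_right y) h0
    simp only [hF, hG, hν]
    rw [h]
  -- Step B: the zeros outside `S` enter with a non-positive sign
  obtain ⟨NS, hNS⟩ : ∃ NS : ℕ, ∀ ρ ∈ S, |ρ.im| + 1 ≤ NS := by
    obtain ⟨B, hB⟩ := (S.image fun ρ ↦ |ρ.im| + 1).exists_le
    refine ⟨⌈max B 0⌉₊, fun ρ hρ ↦ ?_⟩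
    have h1 : |ρ.im| + 1 ≤ B := hB _ (Finset.mem_image_of_mem _ hρ)
    exact h1.trans ((le_max_left B 0).trans (Nat.le_ceil _))
  have hzeros : ∀ n : ℕ, |t| + 2 ≤ (n : ℝ) → (NS : ℝ) ≤ n →
      (∑ᶠ ρ ∈ {ρ : ℂ | riemannZeta₁ ρ = 0 ∧ ρ ∈ Ioo (σ - η) (σ + η) ×ℂ Ioo (-d n) (d n)},
          ((meromorphicOrderAt riemannZeta₁ ρ).untop₀ : ℝ) * (fordCot η (ρ - s)).re) ≤ ZS := by
    intro n hn hnS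
    have hdn : |t| < d n := by linarith [hd_ge n]
    have hc : -d n < t := by have := neg_abs_le t; linarith
    have hd : t < d n := lt_of_le_of_lt (le_abs_self t) hdn
    have hab : σ - η ≤ σ + η := by linarith
    have hsK : s ∈ Icc (σ - η) (σ + η) ×ℂ Icc (-d n) (d n) :=
      ⟨⟨by rw [hsre]; linarith, by rw [hsre]; linarith⟩, ⟨by rw [hsim]; exact hc.le, by rw [hsim]; exact hd.le⟩⟩
    have hfin := finite_zeros_reProdIm hab (by linarith : -d n ≤ d n)
      (fun z _ ↦ differentiable_riemannZeta₁.analyticAt z) hsK h0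
    rw [finsum_mem_eq_finite_toFinset_sum _ hfin]
    set Z := hfin.toFinset with hZ
    have hmemZ : ∀ ρ, ρ ∈ Z ↔ riemannZeta₁ ρ = 0 ∧ ρ ∈ Ioo (σ - η) (σ + η) ×ℂ Ioo (-d n) (d n) :=
      fun ρ ↦ by rw [hZ, Set.Finite.mem_toFinset]; rfl
    -- facts about the zeros in `Z`
    have hZprop : ∀ ρ ∈ Z, ρ ≠ 1 ∧ σ - η < ρ.re ∧ ρ.re < 1 ∧
        ((meromorphicOrderAt riemannZeta₁ ρ).untop₀ : ℝ) = riemannZetaZeroOrder ρ := by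
      intro ρ hρ
      obtain ⟨h0ρ, hρR⟩ := (hmemZ ρ).1 hρ
      have hρ1 := ne_one_of_riemannZeta₁_eq_zero h0ρ
      have hre : σ - η < ρ.re := hρR.1.1
      have hmem := mem_nontrivialZeros_of_riemannZeta₁_eq_zero (by linarith) h0ρ
      have hlt := ((mem_riemannZetaNontrivialZeros_iff_holds).1 hmem).2.2
      refine ⟨hρ1, hre, hlt, ?_⟩
      rw [meromorphicOrderAt_riemannZeta₁_eq hρ1]
      rfl
    have hSZ : S ⊆ Z := by
      intro ρ hρ
      obtain ⟨hζ, hre⟩ := hS ρ hρ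
      have hρ1 : ρ ≠ 1 := fun h ↦ riemannZeta_one_ne_zero (h ▸ hζ)
      have hlt : ρ.re < 1 := by
        by_contra hge
        exact riemannZeta_ne_zero_of_one_le_re (not_lt.1 hge) hζ
      have him : |ρ.im| < d n := by
        have := hNS ρ hρ
        linarith [hd_ge n]
      rw [hmemZ]
      refine ⟨(riemannZeta₁_eq_zero_iff hρ1).2 hζ, ⟨hre, by linarith⟩, ?_⟩
      rw [abs_lt] at him
      exact ⟨him.1, him.2⟩
    rw [← Finset.sum_sdiff hSZ]
    have hneg : ∑ ρ ∈ Z \ S, ((meromorphicOrderAt riemannZeta₁ ρ).untop₀ : ℝ) *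
        (fordCot η (ρ - s)).re ≤ 0 := by
      refine Finset.sum_nonpos fun ρ hρ ↦ ?_
      rw [Finset.mem_sdiff] at hρ
      obtain ⟨hρ1, hre, hlt, hm⟩ := hZprop ρ hρ.1
      have hm0 : 0 ≤ ((meromorphicOrderAt riemannZeta₁ ρ).untop₀ : ℝ) := by
        rw [hm]
        have h0ρ := ((hmemZ ρ).1 hρ.1).1
        have := (riemannZetaZeroOrder_pos_iff hρ1).2 ((riemannZeta₁_eq_zero_iff hρ1).1 h0ρ)
        exact_mod_cast this.le
      refine mul_nonpos_of_nonneg_of_nonpos hm0 (re_fordCot_nonpos hη ?_ ?_)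
      · rw [sub_re, hsre]; linarith
      · rw [sub_re, hsre]; linarith
    have hpos : ∑ ρ ∈ S, ((meromorphicOrderAt riemannZeta₁ ρ).untop₀ : ℝ) * (fordCot η (ρ - s)).re = ZS := by
      refine Finset.sum_congr rfl fun ρ hρ ↦ ?_
      rw [(hZprop ρ (hSZ hρ)).2.2.2]
    linarith
  -- Step C: the horizontal-edge terms
  have hη2 : η ≤ 2 := by linarith
  set A : ℝ := C * (1 + 1 / c₀) + 3 with hA
  set Bc : ℝ := 1 / (2 * π) * 2 * ((2 * η) ^ 2 * A * (ν ^ 2 * (16 * Real.exp (2 * ν * |t|)))) with hBc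
  set E : ℕ → ℝ := fun n ↦ Bc * ((d n + 4) ^ 2 * Real.exp (-(2 * ν * d n))) with hE
  have hhor : ∀ n : ℕ, |t| + 2 ≤ (n : ℝ) →
      |1 / (2 * π) * ((fordHorizontalTerm riemannZeta₁ η s (σ - η) (σ + η) (d n)).im
          - (fordHorizontalTerm riemannZeta₁ η s (σ - η) (σ + η) (-d n)).im)| ≤ E n := by
    intro n hn
    have hdpos : 0 ≤ d n := by linarith [abs_nonneg t, hd_ge n]
    have hyd : |t| + 2 ≤ |d n| := by rw [abs_of_nonneg hdpos]; linarith [hd_ge n]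
    have hyc : |t| + 2 ≤ |(-d n)| := by rwa [abs_neg]
    have Hd := norm_fordHorizontalTerm_riemannZeta₁_le hη hη2 hleft hright hC (hδ0 n) (hδ1 n)
      (fun ρ hρ ↦ (hδsep n ρ hρ).1) hyd
    have Hc := norm_fordHorizontalTerm_riemannZeta₁_le hη hη2 hleft hright hC (hδ0 n) (hδ1 n)
      (fun ρ hρ ↦ by have := (hδsep n ρ hρ).2; rwa [sub_neg_eq_add]) hyc
    rw [abs_neg, abs_of_nonneg hdpos] at Hc
    rw [abs_of_nonneg hdpos] at Hd
    have hMle : C * Real.log (d n + 4) / δ n + 3 ≤ A * (d n + 4) ^ 2 :=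
      edge_bound_le_sq hC0.le hc₀ (hδ0 n) hdpos (hδinv n)
    have hexp : Real.exp (-(2 * (ν * (d n - |t|)))) = Real.exp (2 * ν * |t|) * Real.exp (-(2 * ν * d n)) := by
      rw [← Real.exp_add]; ring_nf
    have hK0 : 0 ≤ ν ^ 2 * (16 * Real.exp (-(2 * (ν * (d n - |t|))))) := by positivity
    have key : ‖fordHorizontalTerm riemannZeta₁ η s (σ - η) (σ + η) (d n)‖ +
        ‖fordHorizontalTerm riemannZeta₁ η s (σ - η) (σ + η) (-d n)‖ ≤
          2 * ((2 * η) ^ 2 * (A * (d n + 4) ^ 2) * (ν ^ 2 * (16 * Real.exp (-(2 * (ν * (d n - |t|))))))) := by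
      have h1 : (2 * η) ^ 2 * (C * Real.log (d n + 4) / δ n + 3) *
          (ν ^ 2 * (16 * Real.exp (-(2 * (ν * (d n - |t|)))))) ≤
          (2 * η) ^ 2 * (A * (d n + 4) ^ 2) * (ν ^ 2 * (16 * Real.exp (-(2 * (ν * (d n - |t|)))))) :=
        mul_le_mul_of_nonneg_right (mul_le_mul_of_nonneg_left hMle (by positivity)) hK0
      simp only [hs] at Hd Hc ⊢
      linarith only [Hd, Hc, h1]
    calc |1 / (2 * π) * ((fordHorizontalTerm riemannZeta₁ η s (σ - η) (σ + η) (d n)).im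
            - (fordHorizontalTerm riemannZeta₁ η s (σ - η) (σ + η) (-d n)).im)|
        = 1 / (2 * π) * |(fordHorizontalTerm riemannZeta₁ η s (σ - η) (σ + η) (d n)).im
            - (fordHorizontalTerm riemannZeta₁ η s (σ - η) (σ + η) (-d n)).im| := by
          rw [abs_mul, abs_of_pos (by positivity)]
      _ ≤ 1 / (2 * π) * (‖fordHorizontalTerm riemannZeta₁ η s (σ - η) (σ + η) (d n)‖ +
            ‖fordHorizontalTerm riemannZeta₁ η s (σ - η) (σ + η) (-d n)‖) := by
          refine mul_le_mul_of_nonneg_left ?_ (by positivity)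
          exact (abs_sub _ _).trans (add_le_add (abs_im_le_norm _) (abs_im_le_norm _))
      _ ≤ 1 / (2 * π) * (2 * ((2 * η) ^ 2 * (A * (d n + 4) ^ 2) *
            (ν ^ 2 * (16 * Real.exp (-(2 * (ν * (d n - |t|)))))))) :=
          mul_le_mul_of_nonneg_left key (by positivity)
      _ = E n := by rw [hE, hBc, hexp]; ring
  -- Step D: limits
  have hd_tend : Tendsto (fun n : ℕ ↦ d n) atTop atTop :=
    tendsto_atTop_mono hd_ge tendsto_natCast_atTop_atTop
  have hJ : Tendsto (fun n : ℕ ↦ ∫ y : ℝ in (-d n : ℝ)..d n, G y) atTop (𝓝 (∫ y, G y)) :=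
    intervalIntegral_tendsto_integral hGint (tendsto_neg_atTop_atBot.comp hd_tend) hd_tend
  have hE0 : Tendsto E atTop (𝓝 0) := by
    have h := (tendsto_sq_mul_exp_neg 4 (by positivity : 0 < 2 * ν)).comp hd_tend
    have h' := h.const_mul Bc
    rw [mul_zero] at h'
    refine h'.congr fun n ↦ ?_
    simp only [hE, Function.comp_apply]
  have hlim : Tendsto (fun n : ℕ ↦ ZS + π / (8 * η ^ 2) * (∫ y : ℝ in (-d n : ℝ)..d n, G y) + E n)
      atTop (𝓝 (ZS + π / (8 * η ^ 2) * (∫ y, G y) + 0)) :=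
    ((hJ.const_mul _).const_add _).add hE0
  rw [add_zero, hGeq] at hlim
  -- Step E: conclusion
  refine ge_of_tendsto hlim ?_
  filter_upwards [eventually_ge_atTop (max ⌈|t| + 2⌉₊ NS)] with n hn
  have hn1 : |t| + 2 ≤ (n : ℝ) := (Nat.le_ceil _).trans (by exact_mod_cast (le_max_left _ _).trans hn)
  have hn2 : (NS : ℝ) ≤ n := by exact_mod_cast (le_max_right _ _).trans hn
  have h1 := hrect n hn1
  have h2 := hzeros n hn1 hn2
  have h3 := hhor n hn1
  have h4 := neg_abs_le (1 / (2 * π) * ((fordHorizontalTerm riemannZeta₁ η s (σ - η) (σ + η) (d n)).im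
          - (fordHorizontalTerm riemannZeta₁ η s (σ - η) (σ + η) (-d n)).im))
  simp only [hF] at h1
  linarith

/-! ### The detector for `ζ` -/

/-- On a vertical line, `∫ log|ζ₁| sech² = ∫ log|ζ| sech² + ∫ log|s − 1| sech²` (`1/2 ≤ x ≤ 3`).
[folklore] -/
theorem integral_log_norm_riemannZeta₁_div_cosh_sq_eq {x : ℝ} (hx : x ∈ Icc (1 / 2 : ℝ) 3) {ν : ℝ}
    (hν : 0 < ν) (t : ℝ) :
    ∫ y : ℝ, Real.log ‖riemannZeta₁ (x + y * I)‖ / Real.cosh (ν * (y - t)) ^ 2 =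
      (∫ y : ℝ, Real.log ‖riemannZeta (x + y * I)‖ / Real.cosh (ν * (y - t)) ^ 2) +
        ∫ y : ℝ, Real.log ‖(x : ℂ) + y * I - 1‖ / Real.cosh (ν * (y - t)) ^ 2 := by
  rw [← integral_add (ZetaLogNormVertical.integrable_log_norm_riemannZeta_div_cosh_sq hx hν t)
    (ZetaLogNormVertical.integrable_log_norm_sub_one_div_cosh_sq hx hν t)]
  refine integral_congr_ae ?_
  filter_upwards [ZetaLogNormVertical.ae_log_norm_riemannZeta_eq hx] with y hy
  rw [hy]; ring

/-- The pole factor decreases to the left: for `σ ≥ 1`, `η > 0`,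
`∫ [log|σ−η−1+iy| − log|σ+η−1+iy|] sech²(ν(y−t)) dy ≤ 0`. [folklore] -/
theorem integral_log_norm_sub_one_diff_nonpos {σ η : ℝ} (hσ : 1 ≤ σ) (hη : 0 < η)
    (hleft : 1 / 2 ≤ σ - η) (hright : σ + η ≤ 3) {ν : ℝ} (hν : 0 < ν) (t : ℝ) :
    (∫ y : ℝ, Real.log ‖((σ - η : ℝ) : ℂ) + y * I - 1‖ / Real.cosh (ν * (y - t)) ^ 2) -
      ∫ y : ℝ, Real.log ‖((σ + η : ℝ) : ℂ) + y * I - 1‖ / Real.cosh (ν * (y - t)) ^ 2 ≤ 0 := by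
  rw [← integral_sub (ZetaLogNormVertical.integrable_log_norm_sub_one_div_cosh_sq ⟨hleft, by linarith⟩ hν t)
    (ZetaLogNormVertical.integrable_log_norm_sub_one_div_cosh_sq ⟨by linarith, hright⟩ hν t)]
  refine integral_nonpos_of_ae ?_
  have hae : ∀ᵐ y : ℝ, y ≠ 0 := by rw [ae_iff]; simp
  filter_upwards [hae] with y hy
  simp only [Pi.zero_apply]
  have hc : 0 < Real.cosh (ν * (y - t)) ^ 2 := by positivity
  rw [sub_nonpos, div_le_div_iff_of_pos_right hc]
  have h1 : ‖((σ - η : ℝ) : ℂ) + y * I - 1‖ ≤ ‖((σ + η : ℝ) : ℂ) + y * I - 1‖ := by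
    rw [show ((σ - η : ℝ) : ℂ) + y * I - 1 = ((σ - η - 1 : ℝ) : ℂ) + ((y : ℝ) : ℂ) * I by push_cast; ring,
      show ((σ + η : ℝ) : ℂ) + y * I - 1 = ((σ + η - 1 : ℝ) : ℂ) + ((y : ℝ) : ℂ) * I by push_cast; ring,
      ← sq_le_sq₀ (norm_nonneg _) (norm_nonneg _), Complex.sq_norm, Complex.sq_norm,
      Complex.normSq_add_mul_I, Complex.normSq_add_mul_I]
    nlinarith
  have h0 : 0 < ‖((σ - η : ℝ) : ℂ) + y * I - 1‖ := by
    refine norm_pos_iff.2 fun h ↦ hy ?_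
    simpa using congrArg Complex.im h
  exact Real.log_le_log h0 h1

/-- **Ford's zero detector for `ζ` on whole vertical lines** (Ford 2002, Lemma 2.2 for `f = ζ`,
with the pole term kept and the zeros outside `S` dropped, as in the proof of his Lemma 4.1). Let
`s = σ + it`, `t ≠ 0`, `σ ≥ 1`, `η > 0`, `1/2 ≤ σ − η`, `σ + η ≤ 3`, no zero of `ζ` on `Re z = σ − η`,
and `S` a finite set of zeros of `ζ` with `Re ρ > σ − η`. Then
`−Re (ζ'/ζ)(s) ≤ (σ − 1)/|s − 1|² + Σ_{ρ ∈ S} m(ρ) Re h_η(ρ − s)`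
`   + (π/8η²) [∫ log|ζ(σ−η+iy)| sech²(π(y−t)/2η) dy − ∫ log|ζ(σ+η+iy)| sech²(π(y−t)/2η) dy]`.
The first term is the contribution of the pole (through `ζ₁ = (s−1)ζ`); it vanishes for `σ = 1`,
which is the case of Ford's Lemma 4.6 and of MTY's Lemmas 4.2/4.7.
[cite: Ford2002Millennium, Lemma 2.2 and proof of Lemma 4.1] -/
theorem neg_re_deriv_riemannZeta_div_le {σ t η : ℝ} (hη : 0 < η) (hσ : 1 ≤ σ)
    (hleft : 1 / 2 ≤ σ - η) (hright : σ + η ≤ 3) (ht : t ≠ 0)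
    (hgood : ∀ ρ : ℂ, riemannZeta ρ = 0 → ρ.re ≠ σ - η)
    (S : Finset ℂ) (hS : ∀ ρ ∈ S, riemannZeta ρ = 0 ∧ σ - η < ρ.re) :
    -(deriv riemannZeta (σ + t * I) / riemannZeta (σ + t * I)).re ≤
      (σ - 1) / ‖(σ : ℂ) + t * I - 1‖ ^ 2
      + (∑ ρ ∈ S, (riemannZetaZeroOrder ρ : ℝ) * (fordCot η (ρ - (σ + t * I))).re)
      + π / (8 * η ^ 2) *
        ((∫ y : ℝ, Real.log ‖riemannZeta ((σ - η : ℝ) + y * I)‖ / Real.cosh (π / (2 * η) * (y - t)) ^ 2)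
          - ∫ y : ℝ, Real.log ‖riemannZeta ((σ + η : ℝ) + y * I)‖ / Real.cosh (π / (2 * η) * (y - t)) ^ 2) := by
  have h := neg_re_deriv_riemannZeta₁_div_le hη hσ hleft hright ht hgood S hS
  set s : ℂ := (σ : ℂ) + t * I with hs
  have hν0 : 0 < π / (2 * η) := by positivity
  have hs1 : s ≠ 1 := by
    intro h1; apply ht; simpa [hs] using congrArg Complex.im h1
  have hζ : riemannZeta s ≠ 0 := riemannZeta_ne_zero_of_one_le_re (by simp [hs]; exact hσ)
  rw [deriv_riemannZeta₁_div_eq hs1 hζ, add_re] at h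
  have hinv : ((s - 1)⁻¹).re = (σ - 1) / ‖s - 1‖ ^ 2 := by
    rw [Complex.inv_re, Complex.normSq_eq_norm_sq]
    simp [hs]
  rw [integral_log_norm_riemannZeta₁_div_cosh_sq_eq ⟨hleft, by linarith⟩ hν0,
    integral_log_norm_riemannZeta₁_div_cosh_sq_eq ⟨by linarith, hright⟩ hν0] at h
  have hP := integral_log_norm_sub_one_diff_nonpos hσ hη hleft hright hν0 t
  have hπ : 0 < π / (8 * η ^ 2) := by positivity
  have key := mul_le_mul_of_nonneg_left hP hπ.le
  rw [mul_zero] at key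
  simp only [hs] at h hinv ⊢
  rw [hinv] at h
  nlinarith [h, key]

/-- **Ford's zero detector for `ζ`, in Ford's parametrisation** (the substitution
`y = t + 2ηu/π` in `neg_re_deriv_riemannZeta_div_le`):
`−Re (ζ'/ζ)(s) ≤ (σ − 1)/|s − 1|² + Σ_{ρ ∈ S} m(ρ) Re h_η(ρ − s)`
`   + (1/4η) [∫ log|ζ(σ − η + i(t + 2ηu/π))|/cosh²u du − ∫ log|ζ(σ + η + i(t + 2ηu/π))|/cosh²u du]`,
i.e. Ford's Lemma 2.2/4.1 display with `fordLogZetaIntegral (σ ∓ η) t (2η/π)` of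
`VinogradovKorobovZeroDetector.lean` (same integrand; that file is not imported here).
[cite: Ford2002Millennium, Lemma 2.2 and Lemma 4.1] -/
theorem ford_zero_detector_zeta {σ t η : ℝ} (hη : 0 < η) (hσ : 1 ≤ σ)
    (hleft : 1 / 2 ≤ σ - η) (hright : σ + η ≤ 3) (ht : t ≠ 0)
    (hgood : ∀ ρ : ℂ, riemannZeta ρ = 0 → ρ.re ≠ σ - η)
    (S : Finset ℂ) (hS : ∀ ρ ∈ S, riemannZeta ρ = 0 ∧ σ - η < ρ.re) :
    -(deriv riemannZeta (σ + t * I) / riemannZeta (σ + t * I)).re ≤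
      (σ - 1) / ‖(σ : ℂ) + t * I - 1‖ ^ 2
      + (∑ ρ ∈ S, (riemannZetaZeroOrder ρ : ℝ) * (fordCot η (ρ - (σ + t * I))).re)
      + 1 / (4 * η) *
        ((∫ u : ℝ, Real.log ‖riemannZeta ((σ - η : ℝ) + ((t + u * (2 * η / π) : ℝ) : ℂ) * I)‖ / Real.cosh u ^ 2)
          - ∫ u : ℝ, Real.log ‖riemannZeta ((σ + η : ℝ) + ((t + u * (2 * η / π) : ℝ) : ℂ) * I)‖ / Real.cosh u ^ 2) := by
  have h := neg_re_deriv_riemannZeta_div_le hη hσ hleft hright ht hgood S hS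
  have hν0 : 0 < π / (2 * η) := by positivity
  have hπ : π ≠ 0 := Real.pi_pos.ne'
  rw [integral_div_cosh_sq_comp (fun y ↦ Real.log ‖riemannZeta ((σ - η : ℝ) + y * I)‖) t hν0,
    integral_div_cosh_sq_comp (fun y ↦ Real.log ‖riemannZeta ((σ + η : ℝ) + y * I)‖) t hν0] at h
  have e1 : 1 / (π / (2 * η)) = 2 * η / π := by rw [one_div_div]
  have e2 : π / (8 * η ^ 2) * (2 * η / π) = 1 / (4 * η) := by
    field_simp; ring
  simp only [e1] at h
  rw [← mul_sub, ← mul_assoc, e2] at h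
  exact h

end FordZetaDetector

end Literature.NumberTheory.LFunctions
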